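import Summits.AtomisticToContinuum.HydrodynamicLimit.Theorems.DenseExcursion.Negative.Dichotomy
import Summits.AtomisticToContinuum.HydrodynamicLimit.Theorems.DenseExcursion.Negative.CompressionBudget
import Summits.AtomisticToContinuum.HydrodynamicLimit.Theorems.ImplosionDichotomyPolynomialCompression

/-!
# `DiluteSelfConsistency` (stmt-AtomisticToContinuum-3091) — the mirror of the `DenseExcursion` record

crux-ideate round 1, ideator 1 (planner-cruxidea-stmt-AtomisticToContinuum-3091-1-0), 2026-08-17.
Companion of `Cruxes/DiluteSelfConsistency/NOTES.md` (decision memo). Kernel-checked bookkeeping only: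

* `dsc_iff_not_denseExcursion` — the crux IS the negation of the rank-2 crux `DenseExcursion` (landed
  `not_denseExcursion_iff_diluteSelfConsistency`), so its prove-chain and the cdisprove seat of stmt-12586 are one job;
* the landed refuted STRENGTHENINGS of `DenseExcursion` re-typed as PROVED WEAKENINGS of this crux in the crux's OWN
  quantifier shape (`∀ Φ, tie through Φ → …`, one flow family suffices by `tendstoHydroFieldsAt_zero_transfer`):
  `diluteOnCompressionBudget` (σ-uniform floor `-K ≤ div u` up to a σ-uniform horizon `T₀` ⇒ packing `< η`) and
  `diluteOnLipschitzVelocity` (σ-uniform `‖Du‖ ≤ M` up to `T₀` ⇒ packing `< η`). These are the only positive rungs in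
  the tree; every further rung is blocked by `polynomialCompression_proof` (density `σ^{-κ}` IS reached) — see the memo.
-/

noncomputable section

namespace Summit.AtomisticToContinuum.HydrodynamicLimit.Cruxes.DiluteSelfConsistency.Mirror

open MeasureTheory Filter Set Topology
open Literature.MathematicalPhysics.KineticTheory Literature.Analysis.FluidPDE Literature.Analysis.FunctionSpaces
open Summit.AtomisticToContinuum.HydrodynamicLimit.Theses.ImplosionDichotomy
open Summit.AtomisticToContinuum.HydrodynamicLimit.Theorems
open Summit.AtomisticToContinuum.HydrodynamicLimit.Theorems.DenseExcursionDichotomy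

/-- The crux is the negation of `DenseExcursion` (landed dichotomy, restated from the positive side). -/
theorem dsc_iff_not_denseExcursion : DiluteSelfConsistency ↔ ¬ DenseExcursion :=
  not_denseExcursion_iff_diluteSelfConsistency.symm

/-- POSITIVE RUNG 1 in the crux's own shape: dilute self-consistency ON A σ-UNIFORM COMPRESSION BUDGET — for every
`K, T₀`, every `η > 0` and all profiles there is `σ₀` such that every classical hard-sphere-Euler solution tied at
`t = 0` through SOME flow family keeps packing `< η` at every time `t ≤ T₀` up to which `-K ≤ div u` held. -/
def DiluteOnCompressionBudget : Prop :=
  ∀ K T₀ : ℝ, ∀ η : ℝ, 0 < η → ∀ (a₀ θ₀ : T3 → ℝ) (u₀ : T3 → V3), Continuous a₀ → Continuous θ₀ → Continuous u₀ →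
    (∀ x, 0 < a₀ x) → (∀ x, 0 < θ₀ x) → ∃ σ₀ : ℝ, 0 < σ₀ ∧ ∀ σ : ℝ, 0 < σ → σ < σ₀ →
      ∀ (T : ℝ) (ρ θ : ℝ → T3 → ℝ) (u : ℝ → T3 → V3), IsHardSphereEulerSolution σ T ρ u θ →
        ∀ Φ : (N : ℕ) → HardSphereFlow (Torus.geometry (Fin 3)) (hsDiameter σ N) (N + 1),
          TendstoHydroFieldsAt (fun N => localGibbsLaw σ a₀ u₀ θ₀ N (Φ N)) Φ ρ u θ 0 →
            ∀ t ∈ Ico 0 T, t ≤ T₀ → (∀ s ∈ Icc 0 t, ∀ x, -K ≤ Torus.divergence (u s) x) →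
              ∀ x, ρ t x * σ ^ 3 < η

/-- POSITIVE RUNG 2 in the crux's own shape: dilute self-consistency UNDER A σ-UNIFORM VELOCITY-GRADIENT BOUND. -/
def DiluteOnLipschitzVelocity : Prop :=
  ∀ M T₀ : ℝ, ∀ η : ℝ, 0 < η → ∀ (a₀ θ₀ : T3 → ℝ) (u₀ : T3 → V3), Continuous a₀ → Continuous θ₀ → Continuous u₀ →
    (∀ x, 0 < a₀ x) → (∀ x, 0 < θ₀ x) → ∃ σ₀ : ℝ, 0 < σ₀ ∧ ∀ σ : ℝ, 0 < σ → σ < σ₀ →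
      ∀ (T : ℝ) (ρ θ : ℝ → T3 → ℝ) (u : ℝ → T3 → V3), IsHardSphereEulerSolution σ T ρ u θ →
        ∀ Φ : (N : ℕ) → HardSphereFlow (Torus.geometry (Fin 3)) (hsDiameter σ N) (N + 1),
          TendstoHydroFieldsAt (fun N => localGibbsLaw σ a₀ u₀ θ₀ N (Φ N)) Φ ρ u θ 0 →
            ∀ t ∈ Ico 0 T, t ≤ T₀ → (∀ s ∈ Icc 0 t, ∀ x, ‖Torus.fderiv (u s) x‖ ≤ M) →
              ∀ x, ρ t x * σ ^ 3 < η

/-- Rung 1 holds (from the landed `denseExcursion_false_boundedCompression` and flow-independence of the tie). -/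
theorem diluteOnCompressionBudget_holds : DiluteOnCompressionBudget := by
  intro K T₀ η hη a₀ θ₀ u₀ ha hθ hu ha0 hθ0
  by_contra h
  push Not at h
  apply denseExcursion_false_boundedCompression
  refine ⟨K, T₀, η, hη, a₀, θ₀, u₀, ha, hθ, hu, ha0, hθ0, fun σ₀ hσ₀ => ?_⟩
  obtain ⟨σ, hσ, hσlt, T, ρ, θ, u, hE, Φ, hΦ, t, ht, htT, hbud, x, hx⟩ := h σ₀ hσ₀
  exact ⟨σ, hσ, hσlt, T, ρ, θ, u, hE, fun Ψ => tendstoHydroFieldsAt_zero_transfer Φ Ψ hΦ,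
    t, ht, htT, hbud, x, hx⟩

/-- Rung 2 holds (from the landed `denseExcursion_false_lipschitzVelocity`). -/
theorem diluteOnLipschitzVelocity_holds : DiluteOnLipschitzVelocity := by
  intro M T₀ η hη a₀ θ₀ u₀ ha hθ hu ha0 hθ0
  by_contra h
  push Not at h
  apply denseExcursion_false_lipschitzVelocity
  refine ⟨M, T₀, η, hη, a₀, θ₀, u₀, ha, hθ, hu, ha0, hθ0, fun σ₀ hσ₀ => ?_⟩
  obtain ⟨σ, hσ, hσlt, T, ρ, θ, u, hE, Φ, hΦ, t, ht, htT, hbud, x, hx⟩ := h σ₀ hσ₀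
  exact ⟨σ, hσ, hσlt, T, ρ, θ, u, hE, fun Ψ => tendstoHydroFieldsAt_zero_transfer Φ Ψ hΦ,
    t, ht, htT, hbud, x, hx⟩

/-- What the two rungs leave: by `polynomialCompression_proof` (density `σ^{-κ}` IS reached along admissible
solutions from fixed profiles) neither hypothesis can hold σ-uniformly up to the first singularity of every profile,
so the crux is decided at the ideal first singularity — the `DenseExcursion` heart. [bookkeeping] -/
theorem rungs_and_polynomialCompression :
    DiluteOnCompressionBudget ∧ DiluteOnLipschitzVelocity ∧ PolynomialCompression :=
  ⟨diluteOnCompressionBudget_holds, diluteOnLipschitzVelocity_holds, polynomialCompression_proof⟩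

end Summit.AtomisticToContinuum.HydrodynamicLimit.Cruxes.DiluteSelfConsistency.Mirror

end
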